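import Summits.Ventures.Crystal3D.Theorems.StickyWulffConstantGenericWallFloorTwistedSquare
import Summits.Ventures.Crystal3D.Theorems.StickyWulffConstantGenericWallFloorExactOnlyWitness
import HarnessLib

/-!
# The fcc own-pattern `111` (a `(100)` adatom-row ball, `|O| = 6`) is not exact-only: two kernel witnesses

Helper for `stmt-Ventures-19480` (GenericWallFloor; general-filling step, per-ball programme E1/E2; cf-p1
ROUTE.md §80(6): SLOTEX C12 violator `111`).  Sequel of `…GenericWallFloorTwistedSquare` (same integer-model
technology: `scaledPattern`, `decide`); kernel witnesses by the cell's literature seat (lit g11, kit j289958 /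
j290014, evidence #43 on the item), landed by a prover seat (Theorems are prover-only).
-/

noncomputable section

namespace Summit.Ventures.Crystal3D.Theorems

open Finset Literature.Geometry.DiscreteGeometry Literature.Barriers.AtomisticToContinuum

/-- Euclidean `3`-space. -/
local notation "E3" => EuclideanSpace ℝ (Fin 3)

/-! ### Plumbing: rescaling and two-set distance bounds for integer models (private copies of the prequel's) -/

/-- Integer-model bookkeeping for the kernel witness (checked by `decide` / rescaling). -/
private theorem intVec_zsmul (k : ℤ) (v : Fin 3 → ℤ) : intVec (k • v) = (k : ℝ) • intVec v := by
  ext i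
  simp [intVec]

/-- Integer-model bookkeeping for the kernel witness (checked by `decide` / rescaling). -/
private theorem scaledPattern_rescale (S : Finset (Fin 3 → ℤ)) {k : ℕ} (hk : k ≠ 0) (N : ℕ) :
    scaledPattern (S.image fun v => (k : ℤ) • v) (k ^ 2 * N) = scaledPattern S N := by
  unfold scaledPattern
  rw [Finset.image_image]
  refine Finset.image_congr fun v _ => ?_
  have hk' : (0 : ℝ) < k := by exact_mod_cast Nat.pos_of_ne_zero hk
  have hsq : Real.sqrt ((k ^ 2 * N : ℕ) : ℝ) = k * Real.sqrt N := by
    push_cast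
    rw [Real.sqrt_mul (by positivity), Real.sqrt_sq hk'.le]
  show (Real.sqrt ((k ^ 2 * N : ℕ) : ℝ))⁻¹ • intVec ((k : ℤ) • v) = (Real.sqrt N)⁻¹ • intVec v
  rw [hsq, intVec_zsmul, smul_smul, Int.cast_natCast]
  congr 1
  field_simp

/-- Integer-model bookkeeping for the kernel witness (checked by `decide` / rescaling). -/
private theorem le_dist_of_mem_scaledPattern₂ {S S' : Finset (Fin 3 → ℤ)} {N M : ℕ}
    (hS : ∀ v ∈ S, ∀ w ∈ S', v ≠ w → (M : ℤ) ≤ sqNormInt (v - w)) {x y : E3}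
    (hx : x ∈ scaledPattern S N) (hy : y ∈ scaledPattern S' N) (hxy : x ≠ y) :
    (Real.sqrt N)⁻¹ * Real.sqrt M ≤ dist x y := by
  obtain ⟨v, hv, rfl⟩ := Finset.mem_image.1 hx
  obtain ⟨w, hw, rfl⟩ := Finset.mem_image.1 hy
  have hvw : v ≠ w := fun h => hxy (by rw [h])
  rw [dist_scaled]
  refine mul_le_mul_of_nonneg_left (Real.sqrt_le_sqrt ?_) (inv_nonneg.2 (Real.sqrt_nonneg _))
  exact_mod_cast hS v hv w hw hvw

/-- Integer-model bookkeeping for the kernel witness (checked by `decide` / rescaling). -/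
private theorem le_dist_of_mem_scaledPattern₂' {S S' : Finset (Fin 3 → ℤ)} {N M : ℕ}
    (hS : ∀ v ∈ S, ∀ w ∈ S', (M : ℤ) ≤ sqNormInt (v - w)) {x y : E3}
    (hx : x ∈ scaledPattern S N) (hy : y ∈ scaledPattern S' N) :
    (Real.sqrt N)⁻¹ * Real.sqrt M ≤ dist x y := by
  obtain ⟨v, hv, rfl⟩ := Finset.mem_image.1 hx
  obtain ⟨w, hw, rfl⟩ := Finset.mem_image.1 hy
  rw [dist_scaled]
  refine mul_le_mul_of_nonneg_left (Real.sqrt_le_sqrt ?_) (inv_nonneg.2 (Real.sqrt_nonneg _))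
  exact_mod_cast hS v hv w hw

/-! ## Part II. The fcc own-pattern `111` ((100) adatom-row ball, `|O| = 6`; SLOTEX C12 violator, cf-p1 ROUTE §80(6))

Own pattern `O₁₁₁` (frame of `fccInt`, norm² `2`): the four vectors of the `(100)` cap on the `−x`
side, `(−1,±1,0), (−1,0,±1)`, and the antipodal pair `(0,−1,1), (0,1,−1)` of the `x = 0` square —
the own neighbours of an adatom in a one-wide row on a `(100)` terrace.  SLOTEX (kit j288720): a
non-exact kissing completion with slack `0.125°`, `27°` off.  Two kernel witnesses (lit g11, kit
j289958 / j290014):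
* `adatomRowDozen` (scale `L = 1330219605`, `N = 2L²`): six free balls, EACH `> 1001/1000` from every
  other ball (contact-free completion: `16` ordered contact pairs = the `8` own–own bonds) and
  `≥ 9/20` from every FCC vector; flexible by `1/2500` with `O` fixed;
* `adatomRowTwinDozen` (scale `8241`, `N = 135828162`): the same cluster with its polar pair snapped
  to the EXACT TWIN positions `(1,1,4)/√18`, `(1,−1,−4)/√18` (mirror images of FCC vectors in the
  `(111)` resp. `(1,−1,−1)` layer planes; each touches two own balls) plus the twisted four
  `(10091,∓3659,±4540), (3951,±10680,±2481)` (touching nothing): `24` ordered contact pairs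
  (`12` bonds) — still not a close-packed dozen.
-/

/-- Integer model of `O₁₁₁` (frame of `fccInt`). -/
def fccOwn111Int : Finset (Fin 3 → ℤ) :=
  {![-1, -1, 0], ![-1, 0, -1], ![-1, 0, 1], ![-1, 1, 0], ![0, -1, 1], ![0, 1, -1]}

/-- `O₁₁₁` as unit vectors. -/
def fccOwn111 : Finset E3 := scaledPattern fccOwn111Int 2

/-- Integer-model bookkeeping for the kernel witness (checked by `decide` / rescaling). -/
private theorem fccOwn111Int_subset : fccOwn111Int ⊆ fccInt := by decide
/-- Integer-model bookkeeping for the kernel witness (checked by `decide` / rescaling). -/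
private theorem card_fccOwn111Int : fccOwn111Int.card = 6 := by decide

/-- `O₁₁₁` consists of six of the twelve FCC vectors. -/
theorem fccOwn111_subset_fcc : fccOwn111 ⊆ fccKissingPattern :=
  Finset.image_subset_image fccOwn111Int_subset

/-- Six own vectors. -/
theorem card_fccOwn111 : fccOwn111.card = 6 := by
  rw [fccOwn111, card_scaledPattern _ (by norm_num), card_fccOwn111Int]

/-! ### II.a  The contact-free completion (scale `1330219605`) -/

/-- `O₁₁₁` at scale `L = 1330219605`. -/
def fccOwn111IntL : Finset (Fin 3 → ℤ) :=
  {![-1330219605, -1330219605, 0], ![-1330219605, 0, -1330219605], ![-1330219605, 0, 1330219605],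
   ![-1330219605, 1330219605, 0], ![0, -1330219605, 1330219605], ![0, 1330219605, -1330219605]}

/-- Integer-model bookkeeping for the kernel witness (checked by `decide` / rescaling). -/
private theorem fccOwn111IntL_eq :
    fccOwn111IntL = fccOwn111Int.image fun v => ((1330219605 : ℕ) : ℤ) • v := by decide

/-- Integer-model bookkeeping for the kernel witness (checked by `decide` / rescaling). -/
private theorem fccOwn111_eqL : fccOwn111 = scaledPattern fccOwn111IntL 3538968395052712050 := by
  rw [fccOwn111IntL_eq, show (3538968395052712050 : ℕ) = 1330219605 ^ 2 * 2 by norm_num,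
    scaledPattern_rescale _ (by norm_num), fccOwn111]

/-- The FCC model at scale `1330219605`. -/
def fccIntL : Finset (Fin 3 → ℤ) :=
  {![1330219605, 1330219605, 0], ![1330219605, -1330219605, 0], ![-1330219605, 1330219605, 0],
   ![-1330219605, -1330219605, 0], ![1330219605, 0, 1330219605], ![1330219605, 0, -1330219605],
   ![-1330219605, 0, 1330219605], ![-1330219605, 0, -1330219605], ![0, 1330219605, 1330219605],
   ![0, 1330219605, -1330219605], ![0, -1330219605, 1330219605], ![0, -1330219605, -1330219605]}

/-- Integer-model bookkeeping for the kernel witness (checked by `decide` / rescaling). -/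
private theorem fccIntL_eq : fccIntL = fccInt.image fun v => ((1330219605 : ℕ) : ℤ) • v := by decide

/-- Integer-model bookkeeping for the kernel witness (checked by `decide` / rescaling). -/
private theorem fccKissingPattern_eqL : fccKissingPattern = scaledPattern fccIntL 3538968395052712050 := by
  rw [fccIntL_eq, show (3538968395052712050 : ℕ) = 1330219605 ^ 2 * 2 by norm_num,
    scaledPattern_rescale _ (by norm_num), fccKissingPattern]

/-- Integer model (scale `√(2·1330219605²)`) of the six free balls of the contact-free completion
(rounded from the SLSQP optimum by the rational parametrisation of `x²+y²+z² = 2`, kit j289958). -/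
def adatomRowFreeInt : Finset (Fin 3 → ℤ) :=
  {![1628528915, -592031960, 732366115], ![1627863705, 591456255, -734307600],
   ![636399075, 1724495955, 400097880], ![446064645, 446064645, 1772292600],
   ![446685967, -445824065, -1772196644], ![636399075, -1724495955, -400097880]}

/-- The six free balls as unit vectors. -/
def adatomRowFree : Finset E3 := scaledPattern adatomRowFreeInt 3538968395052712050

/-- Integer model of the contact-free completed dozen. -/
def adatomRowDozenInt : Finset (Fin 3 → ℤ) := fccOwn111IntL ∪ adatomRowFreeInt

/-- **The adatom-row dozen**: `O₁₁₁ ∪` six free balls touching nothing. -/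
def adatomRowDozen : Finset E3 := scaledPattern adatomRowDozenInt 3538968395052712050

/-- Integer-model bookkeeping for the kernel witness (checked by `decide` / rescaling). -/
private theorem card_adatomRowFreeInt : adatomRowFreeInt.card = 6 := by decide
/-- Integer-model bookkeeping for the kernel witness (checked by `decide` / rescaling). -/
private theorem card_adatomRowDozenInt : adatomRowDozenInt.card = 12 := by decide
/-- Integer-model bookkeeping for the kernel witness (checked by `decide` / rescaling). -/
private theorem sqNormInt_adatomRowDozenInt :
    ∀ v ∈ adatomRowDozenInt, sqNormInt v = (3538968395052712050 : ℕ) := by decide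
/-- Integer-model bookkeeping for the kernel witness (checked by `decide` / rescaling). -/
private theorem sqNormInt_sub_adatomRowDozenInt :
    ∀ v ∈ adatomRowDozenInt, ∀ w ∈ adatomRowDozenInt, v ≠ w →
      ((3538968395052712050 : ℕ) : ℤ) ≤ sqNormInt (v - w) := by decide
/-- Integer-model bookkeeping for the kernel witness (checked by `decide` / rescaling). -/
private theorem sqNormInt_sub_adatomRowFreeInt :
    ∀ v ∈ adatomRowFreeInt, ∀ w ∈ adatomRowDozenInt, v ≠ w →
      ((3548344978661332980 : ℕ) : ℤ) ≤ sqNormInt (v - w) := by decide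
/-- Integer-model bookkeeping for the kernel witness (checked by `decide` / rescaling). -/
private theorem sqNormInt_sub_adatomRowFreeInt_fccIntL :
    ∀ v ∈ adatomRowFreeInt, ∀ w ∈ fccIntL, ((793523629546555050 : ℕ) : ℤ) ≤ sqNormInt (v - w) := by decide
/-- Integer-model bookkeeping for the kernel witness (checked by `decide` / rescaling). -/
private theorem card_contactPairs_adatomRowDozenInt :
    ((adatomRowDozenInt ×ˢ adatomRowDozenInt).filter
      (fun p => sqNormInt (p.1 - p.2) = ((3538968395052712050 : ℕ) : ℤ))).card = 16 := by decide

/-- Integer-model bookkeeping for the kernel witness (checked by `decide` / rescaling). -/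
private theorem adatom_gap :
    (1001 / 1000 : ℝ) < (Real.sqrt (3538968395052712050 : ℕ))⁻¹ * Real.sqrt (3548344978661332980 : ℕ) := by
  have hpos : (0 : ℝ) < Real.sqrt (3538968395052712050 : ℕ) := by positivity
  rw [lt_inv_mul_iff₀ hpos, Real.lt_sqrt (by positivity), mul_pow, Real.sq_sqrt (by positivity)]
  norm_num

/-- Integer-model bookkeeping for the kernel witness (checked by `decide` / rescaling). -/
private theorem adatom_slot_gap :
    (9 / 20 : ℝ) ≤ (Real.sqrt (3538968395052712050 : ℕ))⁻¹ * Real.sqrt (793523629546555050 : ℕ) := by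
  have hpos : (0 : ℝ) < Real.sqrt (3538968395052712050 : ℕ) := by positivity
  rw [le_inv_mul_iff₀ hpos, Real.le_sqrt (by positivity) (by positivity), mul_pow,
    Real.sq_sqrt (by positivity)]
  norm_num

/-- `adatomRowDozen = O₁₁₁ ∪ adatomRowFree`. -/
theorem adatomRowDozen_eq : adatomRowDozen = fccOwn111 ∪ adatomRowFree := by
  rw [fccOwn111_eqL, adatomRowDozen, adatomRowDozenInt, scaledPattern, Finset.image_union]
  rfl

/-- `O₁₁₁ ⊆` adatom-row dozen. -/
theorem fccOwn111_subset_adatomRowDozen : fccOwn111 ⊆ adatomRowDozen := by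
  rw [adatomRowDozen_eq]; exact Finset.subset_union_left

/-- The free six `⊆` adatom-row dozen. -/
theorem adatomRowFree_subset : adatomRowFree ⊆ adatomRowDozen :=
  Finset.image_subset_image Finset.subset_union_right

/-- Twelve balls. -/
theorem card_adatomRowDozen : adatomRowDozen.card = 12 := by
  rw [adatomRowDozen, card_scaledPattern _ (by norm_num), card_adatomRowDozenInt]

/-- Six free balls. -/
theorem card_adatomRowFree : adatomRowFree.card = 6 := by
  rw [adatomRowFree, card_scaledPattern _ (by norm_num), card_adatomRowFreeInt]

/-- **The adatom-row dozen is a kissing arrangement** containing `O₁₁₁`. -/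
theorem isKissingArrangement_adatomRowDozen : IsKissingArrangement adatomRowDozen :=
  ⟨fun _ hx => norm_eq_one_of_mem_scaledPattern (by norm_num) sqNormInt_adatomRowDozenInt hx,
    fun _ hx _ hy hxy =>
      one_le_dist_of_mem_scaledPattern (by norm_num) sqNormInt_sub_adatomRowDozenInt hx hy hxy⟩

/-- **Its free balls touch nothing** (`> 1001/1000` from every other ball). -/
theorem lt_dist_of_mem_adatomRowFree {x y : E3} (hx : x ∈ adatomRowFree) (hy : y ∈ adatomRowDozen)
    (hxy : x ≠ y) : (1001 / 1000 : ℝ) < dist x y :=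
  adatom_gap.trans_le (le_dist_of_mem_scaledPattern₂ sqNormInt_sub_adatomRowFreeInt hx hy hxy)

/-- **Its free balls are `≥ 9/20` from every FCC vector** (angle `≥ 26°`; the optimum is `27.4°` off). -/
theorem le_dist_adatomRowFree_fcc {x p : E3} (hx : x ∈ adatomRowFree) (hp : p ∈ fccKissingPattern) :
    (9 / 20 : ℝ) ≤ dist x p := by
  rw [fccKissingPattern_eqL] at hp
  exact adatom_slot_gap.trans (le_dist_of_mem_scaledPattern₂' sqNormInt_sub_adatomRowFreeInt_fccIntL hx hp)

/-- Disjointness of own and free balls. -/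
theorem disjoint_fccOwn111_adatomRowFree : Disjoint fccOwn111 adatomRowFree := by
  rw [Finset.disjoint_right]
  intro x hx hx'
  have h := le_dist_adatomRowFree_fcc hx (fccOwn111_subset_fcc hx')
  rw [dist_self] at h
  linarith

/-- **Bond count `8`** (`16` ordered contact pairs, all own–own) `≠ 24`. -/
theorem card_contactPairs_adatomRowDozen [DecidablePred fun p : E3 × E3 => dist p.1 p.2 = 1] :
    ((adatomRowDozen ×ˢ adatomRowDozen).filter (fun p => dist p.1 p.2 = 1)).card = 16 := by
  rw [adatomRowDozen, card_contactPairs_scaledPattern _ (by norm_num)]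
  exact card_contactPairs_adatomRowDozenInt

/-- **Not a close-packed dozen.** -/
theorem adatomRowDozen_not_isometricImage :
    ¬ ∃ A : E3 →ₗᵢ[ℝ] E3,
      (↑adatomRowDozen : Set E3) = A '' (↑fccKissingPattern : Set E3) ∨
        (↑adatomRowDozen : Set E3) = A '' (↑hcpKissingPattern : Set E3) := by
  classical
  exact not_isometricImage_of_card_contactPairs_ne (by rw [card_contactPairs_adatomRowDozen]; norm_num)

/-- **Flexibility with `O₁₁₁` fixed**: any six unit vectors `1/2500`-matched to the free six complete
`O₁₁₁` to a kissing dozen whose free balls touch nothing (an open `12`-dimensional family). -/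
theorem isKissingArrangement_own111_union_of_etaMatched {η : ℝ} (hη : η ≤ 1 / 2500) {M : Finset E3}
    (hM : ∀ x ∈ M, ‖x‖ = 1) (hm : EtaMatched η M adatomRowFree) :
    IsKissingArrangement (fccOwn111 ∪ M) ∧
      ∀ x ∈ M, ∀ y ∈ fccOwn111 ∪ M, y ≠ x → 1 < dist x y := by
  obtain ⟨e, he⟩ := hm
  have hMP : ∀ x ∈ M, ∀ y ∈ fccOwn111, 1 < dist x y := by
    intro x hx y hy
    have hx' : ((e ⟨x, hx⟩ : ↥adatomRowFree) : E3) ∈ adatomRowFree := (e ⟨x, hx⟩).2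
    have hne : ((e ⟨x, hx⟩ : ↥adatomRowFree) : E3) ≠ y := by
      intro h
      have h2 := le_dist_adatomRowFree_fcc hx' (fccOwn111_subset_fcc hy)
      rw [h, dist_self] at h2
      linarith
    have hgap := lt_dist_of_mem_adatomRowFree hx' (fccOwn111_subset_adatomRowDozen hy) hne
    have h1 : dist x (e ⟨x, hx⟩ : E3) ≤ η := he ⟨x, hx⟩
    have htri : dist (e ⟨x, hx⟩ : E3) y ≤ dist (e ⟨x, hx⟩ : E3) x + dist x y := dist_triangle _ _ _
    rw [dist_comm (e ⟨x, hx⟩ : E3) x] at htri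
    linarith
  have hMM : ∀ x ∈ M, ∀ y ∈ M, x ≠ y → 1 < dist x y := by
    intro x hx y hy hxy
    have hne : ((e ⟨x, hx⟩ : ↥adatomRowFree) : E3) ≠ (e ⟨y, hy⟩ : E3) := by
      intro h
      have : e ⟨x, hx⟩ = e ⟨y, hy⟩ := Subtype.ext h
      rw [e.injective.eq_iff, Subtype.mk.injEq] at this
      exact hxy this
    have hgap := lt_dist_of_mem_adatomRowFree (e ⟨x, hx⟩).2 (adatomRowFree_subset (e ⟨y, hy⟩).2) hne
    have h1 : dist x (e ⟨x, hx⟩ : E3) ≤ η := he ⟨x, hx⟩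
    have h2 : dist y (e ⟨y, hy⟩ : E3) ≤ η := he ⟨y, hy⟩
    have htri : dist (e ⟨x, hx⟩ : E3) (e ⟨y, hy⟩ : E3) ≤ dist (e ⟨x, hx⟩ : E3) x + dist x y +
        dist y (e ⟨y, hy⟩ : E3) := dist_triangle4 _ _ _ _
    rw [dist_comm (e ⟨x, hx⟩ : E3) x] at htri
    linarith
  refine ⟨⟨?_, ?_⟩, ?_⟩
  · intro x hx
    rcases Finset.mem_union.1 hx with hx | hx
    · exact norm_eq_one_of_mem_fccKissingPattern (fccOwn111_subset_fcc hx)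
    · exact hM x hx
  · intro x hx y hy hxy
    rcases Finset.mem_union.1 hx with hx | hx <;> rcases Finset.mem_union.1 hy with hy | hy
    · exact one_le_dist_of_mem_fccKissingPattern (fccOwn111_subset_fcc hx) (fccOwn111_subset_fcc hy) hxy
    · rw [dist_comm]; exact (hMP y hy x hx).le
    · exact (hMP x hx y hy).le
    · exact (hMM x hx y hy hxy).le
  · intro x hx y hy hyx
    rcases Finset.mem_union.1 hy with hy | hy
    · exact hMP x hx y hy
    · exact hMM x hx y hy (Ne.symm hyx)

/-- **Summary: the fcc own-pattern `111` is not exact-only.** -/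
theorem fccOwn111_not_exactOnly :
    ∃ N : Finset E3, fccOwn111 ⊆ N ∧ N.card = 12 ∧ IsKissingArrangement N ∧
      (¬ ∃ A : E3 →ₗᵢ[ℝ] E3,
        (↑N : Set E3) = A '' (↑fccKissingPattern : Set E3) ∨
          (↑N : Set E3) = A '' (↑hcpKissingPattern : Set E3)) ∧
      (∀ x ∈ N \ fccOwn111, ∀ p ∈ fccKissingPattern, (9 / 20 : ℝ) ≤ dist x p) ∧
      ∀ x ∈ N \ fccOwn111, ∀ y ∈ N, y ≠ x → (1001 / 1000 : ℝ) < dist x y := by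
  have hdiff : adatomRowDozen \ fccOwn111 = adatomRowFree := by
    rw [adatomRowDozen_eq, Finset.union_sdiff_left,
      Finset.sdiff_eq_self_of_disjoint disjoint_fccOwn111_adatomRowFree.symm]
  refine ⟨adatomRowDozen, fccOwn111_subset_adatomRowDozen, card_adatomRowDozen,
    isKissingArrangement_adatomRowDozen, adatomRowDozen_not_isometricImage, ?_, ?_⟩
  · intro x hx p hp
    rw [hdiff] at hx
    exact le_dist_adatomRowFree_fcc hx hp
  · intro x hx y hy hyx
    rw [hdiff] at hx
    exact lt_dist_of_mem_adatomRowFree hx hy (Ne.symm hyx)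

/-! ### II.b  The twin-snapped completion (scale `8241`): two exact twin positions + the twisted four -/

/-- Integer model (scale `8241`, `N = 2·8241² = 135828162`) of `O₁₁₁ ∪ {(1,1,4)/√18, (1,−1,−4)/√18}`
(scaled: `2747·(1,±1,±4)`) `∪` twisted four. -/
def adatomRowTwinDozenInt : Finset (Fin 3 → ℤ) :=
  {![-8241, -8241, 0], ![-8241, 0, -8241], ![-8241, 0, 8241], ![-8241, 8241, 0], ![0, -8241, 8241],
   ![0, 8241, -8241],
   ![2747, 2747, 10988], ![2747, -2747, -10988],
   ![10091, -3659, 4540], ![10091, 3659, -4540], ![3951, 10680, 2481], ![3951, -10680, -2481]}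

/-- The twin-snapped dozen as unit vectors. -/
def adatomRowTwinDozen : Finset E3 := scaledPattern adatomRowTwinDozenInt 135828162

/-- Integer-model bookkeeping for the kernel witness (checked by `decide` / rescaling). -/
private theorem fccOwn111Int8241_eq :
    ({![-8241, -8241, 0], ![-8241, 0, -8241], ![-8241, 0, 8241], ![-8241, 8241, 0], ![0, -8241, 8241],
      ![0, 8241, -8241]} : Finset (Fin 3 → ℤ)) = fccOwn111Int.image fun v => ((8241 : ℕ) : ℤ) • v := by
  decide
/-- Integer-model bookkeeping for the kernel witness (checked by `decide` / rescaling). -/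
private theorem card_adatomRowTwinDozenInt : adatomRowTwinDozenInt.card = 12 := by decide
/-- Integer-model bookkeeping for the kernel witness (checked by `decide` / rescaling). -/
private theorem sqNormInt_adatomRowTwinDozenInt :
    ∀ v ∈ adatomRowTwinDozenInt, sqNormInt v = (135828162 : ℕ) := by decide
/-- Integer-model bookkeeping for the kernel witness (checked by `decide` / rescaling). -/
private theorem sqNormInt_sub_adatomRowTwinDozenInt :
    ∀ v ∈ adatomRowTwinDozenInt, ∀ w ∈ adatomRowTwinDozenInt, v ≠ w →
      ((135828162 : ℕ) : ℤ) ≤ sqNormInt (v - w) := by decide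
/-- `24` ordered contact pairs: `16` own–own and `8` between the twin pair and the own balls
`(−1,0,±1), (0,∓1,±1)`; the twisted four touch nothing. -/
private theorem card_contactPairs_adatomRowTwinDozenInt :
    ((adatomRowTwinDozenInt ×ˢ adatomRowTwinDozenInt).filter
      (fun p => sqNormInt (p.1 - p.2) = ((135828162 : ℕ) : ℤ))).card = 24 := by decide

/-- `O₁₁₁ ⊆` twin-snapped dozen. -/
theorem fccOwn111_subset_adatomRowTwinDozen : fccOwn111 ⊆ adatomRowTwinDozen := by
  have h : fccOwn111 = scaledPattern ({![-8241, -8241, 0], ![-8241, 0, -8241], ![-8241, 0, 8241],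
      ![-8241, 8241, 0], ![0, -8241, 8241], ![0, 8241, -8241]} : Finset (Fin 3 → ℤ)) 135828162 := by
    rw [fccOwn111Int8241_eq, show (135828162 : ℕ) = 8241 ^ 2 * 2 by norm_num,
      scaledPattern_rescale _ (by norm_num), fccOwn111]
  rw [h]
  exact Finset.image_subset_image (by decide)

/-- Twelve balls. -/
theorem card_adatomRowTwinDozen : adatomRowTwinDozen.card = 12 := by
  rw [adatomRowTwinDozen, card_scaledPattern _ (by norm_num), card_adatomRowTwinDozenInt]

/-- **The twin-snapped dozen is a kissing arrangement** containing `O₁₁₁` and the two exact twin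
positions `(1,1,4)/√18`, `(1,−1,−4)/√18`. -/
theorem isKissingArrangement_adatomRowTwinDozen : IsKissingArrangement adatomRowTwinDozen :=
  ⟨fun _ hx => norm_eq_one_of_mem_scaledPattern (by norm_num) sqNormInt_adatomRowTwinDozenInt hx,
    fun _ hx _ hy hxy =>
      one_le_dist_of_mem_scaledPattern (by norm_num) sqNormInt_sub_adatomRowTwinDozenInt hx hy hxy⟩

/-- **Bond count `12`** (`24` ordered contact pairs). -/
theorem card_contactPairs_adatomRowTwinDozen [DecidablePred fun p : E3 × E3 => dist p.1 p.2 = 1] :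
    ((adatomRowTwinDozen ×ˢ adatomRowTwinDozen).filter (fun p => dist p.1 p.2 = 1)).card = 24 := by
  rw [adatomRowTwinDozen, card_contactPairs_scaledPattern _ (by norm_num)]
  exact card_contactPairs_adatomRowTwinDozenInt

/-- **The twin-snapped dozen is not a close-packed dozen** either. -/
theorem adatomRowTwinDozen_not_isometricImage :
    ¬ ∃ A : E3 →ₗᵢ[ℝ] E3,
      (↑adatomRowTwinDozen : Set E3) = A '' (↑fccKissingPattern : Set E3) ∨
        (↑adatomRowTwinDozen : Set E3) = A '' (↑hcpKissingPattern : Set E3) := by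
  classical
  exact not_isometricImage_of_card_contactPairs_ne (by rw [card_contactPairs_adatomRowTwinDozen]; norm_num)

/-- **`O₁₁₁` (the `(100)` adatom-row pattern) is not exact-only** (E2 vocabulary). -/
theorem not_exactOnly_fccOwn111 : ¬ ExactOnly 0 fccOwn111 :=
  not_exactOnly_zero_of_witness fccOwn111_subset_adatomRowDozen card_adatomRowDozen
    isKissingArrangement_adatomRowDozen adatomRowDozen_not_isometricImage

end Summit.Ventures.Crystal3D.Theorems

end
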